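import Literature.Geometry.Lorentzian.ParametricAnnulusGluingKIDJets
import HarnessLib

/-!
# KID exhaustion of an annulus from the jet rigidity of Killing initial data

Topic `Literature/Geometry/Lorentzian`. Everything here is PROVED; no definition, no statement of
`Prop` type is introduced (the jet rigidity `(J)` and the compact-annulus theorem `(E)` are
HYPOTHESES, spelled out in place).

`ParametricAnnulusGluingCore.lean` reduces the named fact `ChruscielDelay_parametricAnnulusGluing`
to the Chruściel–Delay theorem on a compact annulus `(E)` and the **KID exhaustion** `(K)`: smooth
Riemannian coordinate vacuum data `(G, K)` without KIDs on the open annulus `A = {R₁ < ‖z‖ < R₂}`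
of `E3` have no KIDs on some open sub-annulus `{a < ‖z‖ < b}`, `R₁ < a < b < R₂`. This file PROVES
`(K)` from the jet rigidity `(J)` of Killing initial data (a smooth KID on a connected open set
whose one-jet vanishes at a point vanishes; Moncrief 1975, §III, Beig–Chruściel 1997, §2 — see
`ParametricAnnulusGluingKIDJets.lean`) by the classical exhaustion argument
(`kidExhaustion_of_kidJetRigidity`): the KIDs on an open `V` form a real vector space
(`CoordAdjointLinear.lean`) on which, by `(J)`, the jet map at a point `z₀` is injective when `V` is
connected, so the spaces `W_n` of jets at `z₀` of the KIDs on the sub-annuli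
`V_n = {R₁ + ε_n < ‖z‖ < R₂ − ε_n} ↑ A` form a decreasing sequence of subspaces of the
`16`-dimensional jet space `ℝ × E3* × E3 × End(E3)`, hence are eventually constant `= W`; if
`W = 0` then `V_n` is KID-free by `(J)`; otherwise a non-zero `w ∈ W` is the jet of a unique KID on
every `V_n` (`kid_eq_of_kidJetRigidity`), and these glue (`exists_glued_kid`) to a non-trivial
smooth KID on `A` — excluded by hypothesis. This is exactly how Chruściel–Delay pass from "no KIDs
on `Ω`" to "no KIDs on a slightly smaller domain" in §8.6 (the set of KID-free sub-annuli is open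
and non-empty).

* `kidExhaustion_of_kidJetRigidity` — `(J) ⟹ (K)`;
* `ChruscielDelay_parametricAnnulusGluing_of_kidJetRigidity_of_compactCore` — `(J) ∧ (E) ⟹`
  `ChruscielDelay_parametricAnnulusGluing`.

## References

* V. Moncrief, J. Math. Phys. 16 (1975) 493–498, §III. [Moncrief1975]
* R. Beig, P. T. Chruściel, *Killing initial data*, Class. Quantum Grav. 14 (1997) A83–A92, §2.
* P. T. Chruściel, E. Delay, Mém. Soc. Math. Fr. 94 (2003), Thm. 5.9, Prop. 5.10, Cor. 5.11, §8.6.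
  [ChruscielDelay2003]
-/

noncomputable section

set_option maxSynthPendingDepth 3

open Set Function Filter TopologicalSpace Module Metric
open scoped ContDiff Topology

namespace Literature.Geometry.Lorentzian

/-! ### `(J) ⟹ (K)`: KID exhaustion of the annulus -/

/-- **KID exhaustion from jet rigidity**: under `(J)`, smooth Riemannian coordinate vacuum data
without KIDs on the open annulus `{R₁ < ‖z‖ < R₂}` (`0 < R₁`) have no KIDs on some open
sub-annulus `{a < ‖z‖ < b}`, `R₁ < a < b < R₂` (the spaces of jets at a fixed point of the KIDs on
the sub-annuli `{R₁ + ε_n < ‖z‖ < R₂ − ε_n}` decrease with `n` in a `16`-dimensional space, hence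
stabilise; a stable non-zero jet would glue to a non-trivial KID on the whole annulus). This is the
hypothesis `(K)` of `ChruscielDelay_parametricAnnulusGluing_of_kidExhaustion_of_compactCore`.
[cite: Moncrief1975, §III] -/
theorem kidExhaustion_of_kidJetRigidity {ι : Type} [Fintype ι] (b₀ : Basis ι ℝ E3)
    (hJ : ∀ (V : Set E3), IsOpen V → IsConnected V →
      ∀ (G K : E3 → E3 →L[ℝ] E3 →L[ℝ] ℝ), ContDiffOn ℝ ∞ G V → ContDiffOn ℝ ∞ K V →
        (∀ z ∈ V, ∀ v w : E3, G z v w = G z w v ∧ K z v w = K z w v) →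
        (∀ z ∈ V, ∀ v : E3, v ≠ 0 → 0 < G z v v) →
        (∀ z ∈ V, MetricCoord.hamAt G K z = 0 ∧ ∀ Z : E3, MetricCoord.momFn b₀ G K z Z = 0) →
        ∀ (N : E3 → ℝ) (Y : E3 → E3), ContDiffOn ℝ ∞ N V → ContDiffOn ℝ ∞ Y V →
          (∀ z ∈ V, MetricCoord.adjHamG G K N z + MetricCoord.adjMomGS G K Y z = 0 ∧
            MetricCoord.adjHamK G K N z + MetricCoord.adjMomKS G Y z = 0) →
          ∀ z₀ ∈ V, N z₀ = 0 → fderiv ℝ N z₀ = 0 → Y z₀ = 0 → fderiv ℝ Y z₀ = 0 →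
            ∀ z ∈ V, N z = 0 ∧ Y z = 0) :
    ∀ (R₁ R₂ : ℝ), 0 < R₁ → R₁ < R₂ →
      ∀ (G K : E3 → E3 →L[ℝ] E3 →L[ℝ] ℝ),
        ContDiffOn ℝ ∞ G {z : E3 | R₁ < ‖z‖ ∧ ‖z‖ < R₂} →
        ContDiffOn ℝ ∞ K {z : E3 | R₁ < ‖z‖ ∧ ‖z‖ < R₂} →
        (∀ z : E3, R₁ < ‖z‖ → ‖z‖ < R₂ → ∀ v w : E3, G z v w = G z w v ∧ K z v w = K z w v) →
        (∀ z : E3, R₁ < ‖z‖ → ‖z‖ < R₂ → ∀ v : E3, v ≠ 0 → 0 < G z v v) →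
        (∀ z : E3, R₁ < ‖z‖ → ‖z‖ < R₂ →
          MetricCoord.hamAt G K z = 0 ∧ ∀ Z : E3, MetricCoord.momFn b₀ G K z Z = 0) →
        (∀ (N : E3 → ℝ) (Y : E3 → E3),
          ContDiffOn ℝ ∞ N {z : E3 | R₁ < ‖z‖ ∧ ‖z‖ < R₂} →
          ContDiffOn ℝ ∞ Y {z : E3 | R₁ < ‖z‖ ∧ ‖z‖ < R₂} →
          (∀ z : E3, R₁ < ‖z‖ → ‖z‖ < R₂ →
            MetricCoord.adjHamG G K N z + MetricCoord.adjMomGS G K Y z = 0 ∧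
            MetricCoord.adjHamK G K N z + MetricCoord.adjMomKS G Y z = 0) →
          ∀ z : E3, R₁ < ‖z‖ → ‖z‖ < R₂ → N z = 0 ∧ Y z = 0) →
        ∃ a b : ℝ, R₁ < a ∧ a < b ∧ b < R₂ ∧
          ∀ (N : E3 → ℝ) (Y : E3 → E3),
            ContDiffOn ℝ ∞ N {z : E3 | a < ‖z‖ ∧ ‖z‖ < b} →
            ContDiffOn ℝ ∞ Y {z : E3 | a < ‖z‖ ∧ ‖z‖ < b} →
            (∀ z : E3, a < ‖z‖ → ‖z‖ < b →
              MetricCoord.adjHamG G K N z + MetricCoord.adjMomGS G K Y z = 0 ∧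
              MetricCoord.adjHamK G K N z + MetricCoord.adjMomKS G Y z = 0) →
            ∀ z : E3, a < ‖z‖ → ‖z‖ < b → N z = 0 ∧ Y z = 0 := by
  intro R₁ R₂ hR₁ hR₁₂ G K hGs hKs hsym hpos hcv hfree
  have hd : 0 < R₂ - R₁ := sub_pos.2 hR₁₂
  -- the exhaustion `V_n = {R₁ + ε_n < ‖z‖ < R₂ − ε_n}`, `ε_n = (R₂ − R₁)/(n + 4)`
  obtain ⟨ε, hεpos, hεle, hεanti, hεsmall⟩ : ∃ ε : ℕ → ℝ, (∀ n, 0 < ε n) ∧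
      (∀ n, ε n ≤ (R₂ - R₁) / 4) ∧ (∀ m n, m ≤ n → ε n ≤ ε m) ∧
      ∀ δ : ℝ, 0 < δ → ∃ n, ε n < δ := by
    refine ⟨fun n ↦ (R₂ - R₁) / ((n : ℝ) + 4), fun n ↦ by positivity, fun n ↦ ?_, fun m n h ↦ ?_,
      fun δ hδ ↦ ?_⟩
    · exact div_le_div_of_nonneg_left hd.le (by norm_num) (by linarith [(n.cast_nonneg : (0 : ℝ) ≤ n)])
    · exact div_le_div_of_nonneg_left hd.le (by positivity) (by exact_mod_cast Nat.add_le_add_right h 4)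
    · obtain ⟨n, hn⟩ := exists_nat_gt ((R₂ - R₁) / δ)
      refine ⟨n, ?_⟩
      have h1 : R₂ - R₁ < δ * n := by rwa [div_lt_iff₀ hδ, mul_comm] at hn
      rw [div_lt_iff₀ (by positivity)]
      nlinarith
  set V : ℕ → Set E3 := fun n ↦ {z : E3 | R₁ + ε n < ‖z‖ ∧ ‖z‖ < R₂ - ε n} with hV
  have hVA : ∀ n, V n ⊆ {z : E3 | R₁ < ‖z‖ ∧ ‖z‖ < R₂} := fun n z hz ↦
    ⟨by linarith [hz.1, hεpos n], by linarith [hz.2, hεpos n]⟩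
  have hVm : Monotone V := fun m n h z hz ↦
    ⟨by linarith [hz.1, hεanti m n h], by linarith [hz.2, hεanti m n h]⟩
  have hVo : ∀ n, IsOpen (V n) := fun n ↦
    (isOpen_lt continuous_const continuous_norm).inter (isOpen_lt continuous_norm continuous_const)
  -- a common base point
  obtain ⟨z₀, hz₀⟩ : ∃ z₀ : E3, ‖z₀‖ = (R₁ + R₂) / 2 := by
    refine ⟨((R₁ + R₂) / 2) • EuclideanSpace.single (0 : Fin 3) (1 : ℝ), ?_⟩
    rw [norm_smul, PiLp.norm_single, norm_one, mul_one, Real.norm_of_nonneg (by linarith)]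
  have hz₀V : ∀ n, z₀ ∈ V n := fun n ↦
    ⟨by rw [hz₀]; linarith [hεle n], by rw [hz₀]; linarith [hεle n]⟩
  have hVc : ∀ n, IsConnected (V n) := fun n ↦
    ⟨⟨z₀, hz₀V n⟩, isPreconnected_coordAnnulus (by linarith [hεpos n])⟩
  have hexh : ∀ z : E3, R₁ < ‖z‖ → ‖z‖ < R₂ → ∃ n, z ∈ V n := by
    intro z hz1 hz2
    obtain ⟨n, hn⟩ := hεsmall (min (‖z‖ - R₁) (R₂ - ‖z‖)) (lt_min (by linarith) (by linarith))
    exact ⟨n, by linarith [min_le_left (‖z‖ - R₁) (R₂ - ‖z‖)],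
      by linarith [min_le_right (‖z‖ - R₁) (R₂ - ‖z‖)]⟩
  have hU : (⋃ n, V n) = {z : E3 | R₁ < ‖z‖ ∧ ‖z‖ < R₂} :=
    subset_antisymm (iUnion_subset hVA) fun z hz ↦ mem_iUnion.2 (hexh z hz.1 hz.2)
  -- the data on each `V_n`
  have hdat : ∀ n, ContDiffOn ℝ ∞ G (V n) ∧ ContDiffOn ℝ ∞ K (V n) ∧
      (∀ z ∈ V n, ∀ v w : E3, G z v w = G z w v ∧ K z v w = K z w v) ∧
      (∀ z ∈ V n, ∀ v : E3, v ≠ 0 → 0 < G z v v) ∧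
      (∀ z ∈ V n, MetricCoord.hamAt G K z = 0 ∧ ∀ Z : E3, MetricCoord.momFn b₀ G K z Z = 0) :=
    fun n ↦ ⟨hGs.mono (hVA n), hKs.mono (hVA n), fun z hz ↦ hsym z (hVA n hz).1 (hVA n hz).2,
      fun z hz ↦ hpos z (hVA n hz).1 (hVA n hz).2, fun z hz ↦ hcv z (hVA n hz).1 (hVA n hz).2⟩
  have hmet : ∀ n, MetricCoord.IsMetricOn G (V n) := fun n ↦
    MetricCoord.isMetricOn_of_pos (hVo n) (hdat n).1 (fun z hz v w ↦ ((hdat n).2.2.1 z hz v w).1)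
      (hdat n).2.2.2.1
  -- the jet spaces and their stabilisation
  choose W hW using fun n ↦ MetricCoord.exists_kidJetSubmodule (hmet n) (hdat n).2.1 (hz₀V n)
  have hWanti : ∀ {m n : ℕ}, m ≤ n → W n ≤ W m := by
    intro m n h w hw
    obtain ⟨N, Y, hN, hY, hk, hj⟩ := (hW n w).1 hw
    exact (hW m w).2 ⟨N, Y, hN.mono (hVm h), hY.mono (hVm h), fun z hz ↦ hk z (hVm h hz), hj⟩
  obtain ⟨n₁, hn₁⟩ : ∃ n₁, ∀ n, n₁ ≤ n → W n = W n₁ := by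
    have hf : ∀ {m n : ℕ}, m ≤ n → finrank ℝ (W n) ≤ finrank ℝ (W m) := fun h ↦
      Submodule.finrank_mono (hWanti h)
    obtain ⟨n₁, hn₁⟩ := Nat.sInf_mem (Set.range_nonempty fun n ↦ finrank ℝ (W n))
    refine ⟨n₁, fun n hn ↦ Submodule.eq_of_le_of_finrank_eq (hWanti hn) (le_antisymm (hf hn) ?_)⟩
    have h := Nat.sInf_le (Set.mem_range_self (f := fun n ↦ finrank ℝ (W n)) n)
    rw [← hn₁] at h
    exact h
  by_cases hbot : W n₁ = ⊥
  · -- `V_{n₁}` is KID-free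
    refine ⟨R₁ + ε n₁, R₂ - ε n₁, by linarith [hεpos n₁], by linarith [hεle n₁], by linarith [hεpos n₁],
      ?_⟩
    intro N Y hN hY hk z hz1 hz2
    have hk' : ∀ z ∈ V n₁, MetricCoord.adjHamG G K N z + MetricCoord.adjMomGS G K Y z = 0 ∧
        MetricCoord.adjHamK G K N z + MetricCoord.adjMomKS G Y z = 0 := fun z hz ↦ hk z hz.1 hz.2
    have hmemW : (N z₀, fderiv ℝ N z₀, Y z₀, fderiv ℝ Y z₀) ∈ W n₁ :=
      (hW n₁ _).2 ⟨N, Y, hN, hY, hk', rfl⟩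
    rw [hbot, Submodule.mem_bot, Prod.mk_eq_zero, Prod.mk_eq_zero, Prod.mk_eq_zero] at hmemW
    obtain ⟨h1, h2, h3, h4⟩ := hmemW
    exact hJ (V n₁) (hVo _) (hVc _) G K (hdat n₁).1 (hdat n₁).2.1 (hdat n₁).2.2.1 (hdat n₁).2.2.2.1
      (hdat n₁).2.2.2.2 N Y hN hY hk' z₀ (hz₀V _) h1 h2 h3 h4 z ⟨hz1, hz2⟩
  · -- a stable non-zero jet glues to a non-trivial KID on the whole annulus: contradiction
    exfalso
    obtain ⟨w, hwW, hw0⟩ := (Submodule.ne_bot_iff (W n₁)).1 hbot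
    have hwn : ∀ n, n₁ ≤ n → ∃ (N : E3 → ℝ) (Y : E3 → E3), ContDiffOn ℝ ∞ N (V n) ∧
        ContDiffOn ℝ ∞ Y (V n) ∧
        (∀ z ∈ V n, MetricCoord.adjHamG G K N z + MetricCoord.adjMomGS G K Y z = 0 ∧
          MetricCoord.adjHamK G K N z + MetricCoord.adjMomKS G Y z = 0) ∧
        (N z₀, fderiv ℝ N z₀, Y z₀, fderiv ℝ Y z₀) = w := fun n hn ↦
      (hW n w).1 (by rw [hn₁ n hn]; exact hwW)
    choose! Nf Yf hNf hYf hkf hjf using hwn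
    -- compatibility, by uniqueness of the KID with jet `w` on each `V_m`
    have hcompat : ∀ m n, n₁ ≤ m → m ≤ n → ∀ z ∈ V m, Nf n z = Nf m z ∧ Yf n z = Yf m z := by
      intro m n hm hmn
      have hn : n₁ ≤ n := hm.trans hmn
      have hj := (hjf n hn).trans (hjf m hm).symm
      simp only [Prod.mk.injEq] at hj
      obtain ⟨e1, e2, e3, e4⟩ := hj
      exact kid_eq_of_kidJetRigidity b₀ hJ (hVo m) (hVc m) (hdat m).1 (hdat m).2.1 (hdat m).2.2.1
        (hdat m).2.2.2.1 (hdat m).2.2.2.2 ((hNf n hn).mono (hVm hmn)) (hNf m hm)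
        ((hYf n hn).mono (hVm hmn)) (hYf m hm) (fun z hz ↦ hkf n hn z (hVm hmn hz)) (hkf m hm)
        (hz₀V m) e1 e2 e3 e4
    obtain ⟨Ng, Yg, hNg, hYg, hkg, hag⟩ :=
      exists_glued_kid V hVo hVm n₁ Nf Yf (fun n hn ↦ ⟨hNf n hn, hYf n hn⟩) hkf hcompat
    rw [hU] at hNg hYg hkg
    have hzero := hfree Ng Yg hNg hYg (fun z hz1 hz2 ↦ hkg z ⟨hz1, hz2⟩)
    -- the jet of the glued KID at `z₀` is `w`, and it vanishes: `w = 0`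
    apply hw0
    have hA : {z : E3 | R₁ < ‖z‖ ∧ ‖z‖ < R₂} ∈ 𝓝 z₀ :=
      ((isOpen_lt continuous_const continuous_norm).inter
        (isOpen_lt continuous_norm continuous_const)).mem_nhds (hVA 0 (hz₀V 0))
    have hevN : Ng =ᶠ[𝓝 z₀] fun _ ↦ (0 : ℝ) := by
      filter_upwards [hA] with y hy
      exact (hzero y hy.1 hy.2).1
    have hevY : Yg =ᶠ[𝓝 z₀] fun _ ↦ (0 : E3) := by
      filter_upwards [hA] with y hy
      exact (hzero y hy.1 hy.2).2
    have hev1N : Ng =ᶠ[𝓝 z₀] Nf n₁ := by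
      filter_upwards [(hVo n₁).mem_nhds (hz₀V n₁)] with y hy
      exact (hag n₁ le_rfl y hy).1
    have hev1Y : Yg =ᶠ[𝓝 z₀] Yf n₁ := by
      filter_upwards [(hVo n₁).mem_nhds (hz₀V n₁)] with y hy
      exact (hag n₁ le_rfl y hy).2
    rw [← hjf n₁ le_rfl, ← hev1N.eq_of_nhds, ← hev1Y.eq_of_nhds, ← hev1N.fderiv_eq,
      ← hev1Y.fderiv_eq, hevN.fderiv_eq, hevY.fderiv_eq, hevN.eq_of_nhds, hevY.eq_of_nhds]
    simp

/-- **`ChruscielDelay_parametricAnnulusGluing` from the jet rigidity of KIDs `(J)` and the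
Chruściel–Delay theorem on a compact annulus `(E)`**: `(J) ⟹ (K)`
(`kidExhaustion_of_kidJetRigidity`) and `(K) ∧ (E) ⟹` the fact
(`ChruscielDelay_parametricAnnulusGluing_of_kidExhaustion_of_compactCore`, where `(E)` is spelled
out). Neither `(J)` nor `(E)` is proved in the tree.
[cite: ChruscielDelay2003, Thm. 5.9, Prop. 5.10, Cor. 5.11 and §8.6] -/
theorem ChruscielDelay_parametricAnnulusGluing_of_kidJetRigidity_of_compactCore {ι : Type}
    [Fintype ι] (b₀ : Basis ι ℝ E3)
    (hJ : ∀ (V : Set E3), IsOpen V → IsConnected V →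
      ∀ (G K : E3 → E3 →L[ℝ] E3 →L[ℝ] ℝ), ContDiffOn ℝ ∞ G V → ContDiffOn ℝ ∞ K V →
        (∀ z ∈ V, ∀ v w : E3, G z v w = G z w v ∧ K z v w = K z w v) →
        (∀ z ∈ V, ∀ v : E3, v ≠ 0 → 0 < G z v v) →
        (∀ z ∈ V, MetricCoord.hamAt G K z = 0 ∧ ∀ Z : E3, MetricCoord.momFn b₀ G K z Z = 0) →
        ∀ (N : E3 → ℝ) (Y : E3 → E3), ContDiffOn ℝ ∞ N V → ContDiffOn ℝ ∞ Y V →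
          (∀ z ∈ V, MetricCoord.adjHamG G K N z + MetricCoord.adjMomGS G K Y z = 0 ∧
            MetricCoord.adjHamK G K N z + MetricCoord.adjMomKS G Y z = 0) →
          ∀ z₀ ∈ V, N z₀ = 0 → fderiv ℝ N z₀ = 0 → Y z₀ = 0 → fderiv ℝ Y z₀ = 0 →
            ∀ z ∈ V, N z = 0 ∧ Y z = 0)
    (hE : ∀ (R₁ a a' b' b R₂ : ℝ), 0 < R₁ → R₁ < a → a < a' → a' < b' → b' < b → b < R₂ →
      ∀ (G K : EuclideanSpace ℝ (Fin 1) → E3 → E3 →L[ℝ] E3 →L[ℝ] ℝ),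
        ContDiffOn ℝ ∞ (fun p : EuclideanSpace ℝ (Fin 1) × E3 ↦ G p.1 p.2)
          ((univ : Set (EuclideanSpace ℝ (Fin 1))) ×ˢ {z : E3 | R₁ < ‖z‖ ∧ ‖z‖ < R₂}) →
        ContDiffOn ℝ ∞ (fun p : EuclideanSpace ℝ (Fin 1) × E3 ↦ K p.1 p.2)
          ((univ : Set (EuclideanSpace ℝ (Fin 1))) ×ˢ {z : E3 | R₁ < ‖z‖ ∧ ‖z‖ < R₂}) →
        (∀ c, ∀ z : E3, R₁ < ‖z‖ → ‖z‖ < R₂ → ∀ v w : E3,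
          G c z v w = G c z w v ∧ K c z v w = K c z w v) →
        (∀ c, ∀ z : E3, R₁ < ‖z‖ → ‖z‖ < R₂ → ∀ v : E3, v ≠ 0 → 0 < G c z v v) →
        (∀ z : E3, R₁ < ‖z‖ → ‖z‖ < R₂ →
          MetricCoord.hamAt (G 0) (K 0) z = 0 ∧
            ∀ Z : E3, MetricCoord.momFn b₀ (G 0) (K 0) z Z = 0) →
        (∀ c, ∀ z : E3, R₁ < ‖z‖ → ‖z‖ < R₂ → (‖z‖ < a' ∨ b' < ‖z‖) →
          MetricCoord.hamAt (G c) (K c) z = 0 ∧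
            ∀ Z : E3, MetricCoord.momFn b₀ (G c) (K c) z Z = 0) →
        (∀ (N : E3 → ℝ) (Y : E3 → E3),
          ContDiffOn ℝ ∞ N {z : E3 | a < ‖z‖ ∧ ‖z‖ < b} →
          ContDiffOn ℝ ∞ Y {z : E3 | a < ‖z‖ ∧ ‖z‖ < b} →
          (∀ z : E3, a < ‖z‖ → ‖z‖ < b →
            MetricCoord.adjHamG (G 0) (K 0) N z + MetricCoord.adjMomGS (G 0) (K 0) Y z = 0 ∧
            MetricCoord.adjHamK (G 0) (K 0) N z + MetricCoord.adjMomKS (G 0) Y z = 0) →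
          ∀ z : E3, a < ‖z‖ → ‖z‖ < b → N z = 0 ∧ Y z = 0) →
        ∃ (r : ℝ) (G' K' : EuclideanSpace ℝ (Fin 1) → E3 → E3 →L[ℝ] E3 →L[ℝ] ℝ), 0 < r ∧
          ContDiffOn ℝ ∞ (fun p : EuclideanSpace ℝ (Fin 1) × E3 ↦ G' p.1 p.2)
            (ball (0 : EuclideanSpace ℝ (Fin 1)) r ×ˢ {z : E3 | R₁ < ‖z‖ ∧ ‖z‖ < R₂}) ∧
          ContDiffOn ℝ ∞ (fun p : EuclideanSpace ℝ (Fin 1) × E3 ↦ K' p.1 p.2)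
            (ball (0 : EuclideanSpace ℝ (Fin 1)) r ×ˢ {z : E3 | R₁ < ‖z‖ ∧ ‖z‖ < R₂}) ∧
          (∀ c ∈ ball (0 : EuclideanSpace ℝ (Fin 1)) r, ∀ z : E3, R₁ < ‖z‖ → ‖z‖ < R₂ →
            ∀ v w : E3, G' c z v w = G' c z w v ∧ K' c z v w = K' c z w v) ∧
          (∀ c ∈ ball (0 : EuclideanSpace ℝ (Fin 1)) r, ∀ z : E3, R₁ < ‖z‖ → ‖z‖ < R₂ →
            ∀ v : E3, v ≠ 0 → 0 < G' c z v v) ∧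
          (∀ c ∈ ball (0 : EuclideanSpace ℝ (Fin 1)) r, ∀ z : E3, R₁ < ‖z‖ → ‖z‖ < R₂ →
            MetricCoord.hamAt (G' c) (K' c) z = 0 ∧
              ∀ Z : E3, MetricCoord.momFn b₀ (G' c) (K' c) z Z = 0) ∧
          (∀ z : E3, R₁ < ‖z‖ → ‖z‖ < R₂ → G' 0 z = G 0 z ∧ K' 0 z = K 0 z) ∧
          (∀ c ∈ ball (0 : EuclideanSpace ℝ (Fin 1)) r, ∀ z : E3, R₁ < ‖z‖ → ‖z‖ < R₂ →
            (‖z‖ < a ∨ b < ‖z‖) → G' c z = G c z ∧ K' c z = K c z)) :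
    ChruscielDelay_parametricAnnulusGluing :=
  ChruscielDelay_parametricAnnulusGluing_of_kidExhaustion_of_compactCore b₀
    (kidExhaustion_of_kidJetRigidity b₀ hJ) hE

end Literature.Geometry.Lorentzian

end
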